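import Summits.AtomisticToContinuum.Crystallization.Theorems.FrustratedLawDichotomyAtlasReachTransport

/-!
# FrustratedLawDichotomy · crux `AperiodicFrustratedLawGap` (stmt-AtomisticToContinuum-27623) — THE REACH LEMMA IN ITS GENERAL FORM:
# any integrable functional, any null ledger, the cap read ONLY at uncovered Nash roots (decomp-a2c, hand-2 g50, structural share «most general lemma first»)

The reach files (404) `…AtlasReach` (sitewise cap `∀ μ hard-core, e⋆ − rootEnergy μ ≤ D`), (407) `…SharpDeficitCap` (`D = 5`), (404′)
`…AtlasReachTransport` (transported cap `e⋆ − rootEnergy μ − net F G μ ≤ D`) and the ceiling (410) `…Negative.OffAtlasCapCeiling` (`D ≥ 0.613` for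
every SITEWISE cap, by one over-coordinated non-Nash 177-point cluster) all run ONE piece of bookkeeping.  This file states that piece once, at its
natural generality, and recovers the law-level and crux-level forms as specialisations:

* §1 ★★ `lt_integral_of_atlasLedger` (pure measure theory; any probability law `P` on any measurable space of «configurations», here `Measure E3`):
  an integrable functional `E`, an integrable NULL LEDGER `Φ` (`∫ Φ dP ≤ 0` — e.g. `0`, or the net flow `net F G` of two covariant transports, whose
  mean vanishes by mass transport), rows `K i` (`i < n`) with a.s. floors `c + m_i ≤ E + Φ` on `K i` and margins `m_i ≥ m > 0`, and an a.s. CAP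
  `c − E − Φ ≤ D` read ONLY ON THE UNCOVERED SET `U = (⋃_{i<n} K i)ᶜ`; then `P(U) < reach m D = m/(m+D)` forces `c < ∫ E dP`.
  (Proof: integrate the booked envelope `c + Σ_i m_i·1_{rowCell i} − D·1_U ≤ E + Φ`; the first-hit cells partition the covered set.)
* §2 ★★ crux level, `coherentMassExclusion_of_floorsL`: for ANY ledger `Φ : Measure E3 → ℝ` that is integrable with mean `≤ 0` under every
  point-stationary probability law a.s. carried by rooted `7/10`-hard-core configurations, deterministic floors `e⋆ + m_i ≤ rootEnergy μ + Φ μ` at the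
  rooted hard-core NASH configurations of row `i`, and a cap `e⋆ − rootEnergy μ − Φ μ ≤ D` required ONLY at rooted hard-core NASH configurations
  OUTSIDE every row, give F(η) = `CoherentMassExclusion n K η` for all `η ≤ reach m D`; `aperiodicFrustratedLawGap_of_offAtlasMassGapL`: + A(η) ⟹ crux.
* §3 specialisations BY NAME: `Φ = 0` ⟹ `coherentMassExclusion_of_floors_nashCap` — (404)'s floors with the cap slot SHRUNK to uncovered Nash roots
  ((404) `coherentMassExclusion_of_floors` asks the cap at every hard-core configuration; (410)'s witness, neither Nash nor anywhere tested for row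
  membership, is a statement about THAT slot only); `Φ = net F G` with the door clauses of (325) ⟹ `coherentMassExclusion_of_floorsT_nashCap` — (404′)
  with the same shrunk slot; both with their `…_of_offAtlasMassGap…` junctions to the route decl through (404) `aperiodicFrustratedLawGap_of_massSplit`.
HONEST LABELS.  Bookkeeping only: no numeric cap is claimed for the shrunk slot (a certified `D` over uncovered Nash roots is the same kind of
instrument as K2 of the lens-5 memo, kit-sized); F(η) stays WEAKER than the crux and A(η) (`OffAtlasMassGap`, the residual of record) is untouched.
What is gained is FORM: one lemma whose hypotheses are exactly what a certificate must supply (floors on rows, a cap off rows at Nash roots, a null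
ledger), so that every future cap/transport certificate plugs into the same three slots.  DEF-FREE (theorems only); imports TREE (404′)
`…AtlasReachTransport` (hence (404), (325), `…SignedLedger`, `…MarginLedger`) only; no instance / notation / option; 0 sorry.  Tags: [new: bookkeeping].
-/

noncomputable section

namespace Summit.AtomisticToContinuum.Crystallization.Theorems.FrustratedLawDichotomyAtlasReachLedger

open MeasureTheory Set Filter
open scoped ENNReal BigOperators
open Literature.MathematicalPhysics.StatisticalMechanics Literature.Probability.Process
open Summit.AtomisticToContinuum.Crystallization.Theorems.ChargedEnergyGapNegative (E3 eStar)
open Summit.AtomisticToContinuum.Crystallization.Theorems.FrustratedLawDichotomyMarginLedger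
  (net_zero rowCell rowCell_subset measurableSet_rowCell eq_of_mem_rowCell exists_mem_rowCell)
open Summit.AtomisticToContinuum.Crystallization.Theorems.FrustratedLawDichotomyFiniteClusterGap (integrable_rootEnergy_of_ae_hardCore)
open Summit.AtomisticToContinuum.Crystallization.Theorems.FrustratedLawDichotomySignedLedger (net integral_net_eq_zero)
open Summit.AtomisticToContinuum.Crystallization.Theorems.FrustratedLawDichotomyAtlasDoorTransport (lintegral_outflow_ne_top_of_bdd)
open Summit.AtomisticToContinuum.Crystallization.Theorems.FrustratedLawDichotomyAtlasReach
  (reach mul_measureReal_le_credit CoherentMassExclusion OffAtlasMassGap aperiodicFrustratedLawGap_of_massSplit)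

variable {P : Measure (Measure E3)} {n : ℕ} {K : ℕ → Set (Measure E3)} {mK : ℕ → ℝ}

/-! ## §1. Law level: the reach lemma for an arbitrary integrable functional and an arbitrary null ledger -/

/-- On the first-hit cell of row `i < n` the booked margin sum reads `m_i`. [new: bookkeeping] -/
theorem sum_indicator_rowCell_of_mem {μ : Measure E3} {i : ℕ} (hi : i ∈ Finset.range n) (hμ : μ ∈ rowCell K i) :
    ∑ j ∈ Finset.range n, (rowCell K j).indicator (fun _ => mK j) μ = mK i := by
  rw [Finset.sum_eq_single_of_mem i hi fun j _ hji => ?_]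
  · exact Set.indicator_of_mem hμ _
  · exact Set.indicator_of_notMem (fun hμj => hji (eq_of_mem_rowCell hμj hμ)) _

/-- Off the rows the booked margin sum vanishes. [new: bookkeeping] -/
theorem sum_indicator_rowCell_of_not_mem {μ : Measure E3} (hμ : μ ∉ ⋃ i ∈ Finset.range n, K i) :
    ∑ j ∈ Finset.range n, (rowCell K j).indicator (fun _ => mK j) μ = 0 :=
  Finset.sum_eq_zero fun j hj => Set.indicator_of_notMem (fun h => hμ (Set.mem_biUnion hj (rowCell_subset K j h))) _

/-- ★ THE BOOKED ENVELOPE lies below `E + Φ` almost surely: floors on the rows, the cap on the uncovered set. [new: bookkeeping] -/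
theorem envelope_le_ae {E Φ : Measure E3 → ℝ} {c D : ℝ}
    (hfloor : ∀ i < n, ∀ᵐ μ ∂P, μ ∈ K i → c + mK i ≤ E μ + Φ μ)
    (hcap : ∀ᵐ μ ∂P, μ ∉ (⋃ i ∈ Finset.range n, K i) → c - E μ - Φ μ ≤ D) :
    ∀ᵐ μ ∂P, c + (∑ j ∈ Finset.range n, (rowCell K j).indicator (fun _ => mK j) μ
      - (⋃ i ∈ Finset.range n, K i)ᶜ.indicator (fun _ => D) μ) ≤ E μ + Φ μ := by
  have hall : ∀ᵐ μ ∂P, ∀ i, i < n → μ ∈ K i → c + mK i ≤ E μ + Φ μ := by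
    refine ae_all_iff.2 fun i => ?_
    by_cases hi : i < n
    · filter_upwards [hfloor i hi] with μ h using fun _ => h
    · exact ae_of_all _ fun μ hi' => absurd hi' hi
  filter_upwards [hall, hcap] with μ hμ hcμ
  by_cases hcov : μ ∈ ⋃ i ∈ Finset.range n, K i
  · obtain ⟨i, hi, hμi⟩ := exists_mem_rowCell hcov
    rw [sum_indicator_rowCell_of_mem hi hμi, Set.indicator_of_notMem (Set.notMem_compl_iff.2 hcov), sub_zero]
    exact hμ i (Finset.mem_range.1 hi) (rowCell_subset K i hμi)
  · rw [sum_indicator_rowCell_of_not_mem hcov, Set.indicator_of_mem (Set.mem_compl hcov), zero_sub]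
    linarith [hcμ hcov]

/-- ★ THE MEAN OF THE BOOKED ENVELOPE = `c` + booked credit of the first-hit cells − `D`·(uncovered mass). [new: bookkeeping] -/
theorem integral_envelope [IsProbabilityMeasure P] (hK : ∀ i, MeasurableSet (K i)) (c D : ℝ) :
    ∫ μ, (c + (∑ j ∈ Finset.range n, (rowCell K j).indicator (fun _ => mK j) μ - (⋃ i ∈ Finset.range n, K i)ᶜ.indicator (fun _ => D) μ)) ∂P =
      c + (∑ i ∈ Finset.range n, mK i * P.real (rowCell K i) - D * P.real (⋃ i ∈ Finset.range n, K i)ᶜ) := by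
  have hU : MeasurableSet (⋃ i ∈ Finset.range n, K i) := Finset.measurableSet_biUnion _ fun j _ => hK j
  have hI1 : Integrable (fun μ => ∑ j ∈ Finset.range n, (rowCell K j).indicator (fun _ => mK j) μ) P :=
    integrable_finsetSum _ fun i _ => (integrable_const (mK i)).indicator (measurableSet_rowCell hK i)
  have hI2 : Integrable ((⋃ i ∈ Finset.range n, K i)ᶜ.indicator fun _ => D) P := (integrable_const D).indicator hU.compl
  have hI12 : Integrable (fun μ => ∑ j ∈ Finset.range n, (rowCell K j).indicator (fun _ => mK j) μ
      - (⋃ i ∈ Finset.range n, K i)ᶜ.indicator (fun _ => D) μ) P := hI1.sub hI2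
  rw [integral_add (integrable_const c) hI12, integral_const, smul_eq_mul, probReal_univ, one_mul, integral_sub hI1 hI2,
    integral_finsetSum _ fun i _ => (integrable_const (mK i)).indicator (measurableSet_rowCell hK i), integral_indicator_const _ hU.compl,
    smul_eq_mul, mul_comm _ D]
  have h1 : ∀ i ∈ Finset.range n, ∫ μ, (rowCell K i).indicator (fun _ => mK i) μ ∂P = mK i * P.real (rowCell K i) := fun i _ => by
    rw [integral_indicator_const _ (measurableSet_rowCell hK i), smul_eq_mul, mul_comm]
  rw [Finset.sum_congr rfl h1]

/-- ★★ **THE REACH LEMMA, GENERAL FORM.**  `P` a probability law, `E` an integrable functional, `Φ` an integrable NULL LEDGER (`∫ Φ dP ≤ 0`), rows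
`K i` (`i < n`, measurable) with almost-sure floors `c + m_i ≤ E + Φ` and margins `m_i ≥ m > 0`, an almost-sure cap `c − E − Φ ≤ D` (`D ≥ 0`) read ONLY
on the uncovered set `U = (⋃_{i<n} K i)ᶜ`, and `P(U) < reach m D = m/(m+D)`: then `c < ∫ E dP`. [new: bookkeeping] -/
theorem lt_integral_of_atlasLedger [IsProbabilityMeasure P] {E Φ : Measure E3 → ℝ} (hE : Integrable E P) (hΦ : Integrable Φ P)
    (hΦ0 : ∫ μ, Φ μ ∂P ≤ 0) (hK : ∀ i, MeasurableSet (K i)) {c m D : ℝ} (hm0 : 0 < m) (hD : 0 ≤ D) (hm : ∀ i < n, m ≤ mK i)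
    (hfloor : ∀ i < n, ∀ᵐ μ ∂P, μ ∈ K i → c + mK i ≤ E μ + Φ μ)
    (hcap : ∀ᵐ μ ∂P, μ ∉ (⋃ i ∈ Finset.range n, K i) → c - E μ - Φ μ ≤ D)
    (hmass : P.real (⋃ i ∈ Finset.range n, K i)ᶜ < reach m D) : c < ∫ μ, E μ ∂P := by
  have hU : MeasurableSet (⋃ i ∈ Finset.range n, K i) := Finset.measurableSet_biUnion _ fun j _ => hK j
  have hI1 : Integrable (fun μ => ∑ j ∈ Finset.range n, (rowCell K j).indicator (fun _ => mK j) μ) P :=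
    integrable_finsetSum _ fun i _ => (integrable_const (mK i)).indicator (measurableSet_rowCell hK i)
  have hI2 : Integrable ((⋃ i ∈ Finset.range n, K i)ᶜ.indicator fun _ => D) P := (integrable_const D).indicator hU.compl
  have hIenv : Integrable (fun μ => c + (∑ j ∈ Finset.range n, (rowCell K j).indicator (fun _ => mK j) μ
      - (⋃ i ∈ Finset.range n, K i)ᶜ.indicator (fun _ => D) μ)) P := (integrable_const c).add (hI1.sub hI2)
  have hIEΦ : Integrable (fun μ => E μ + Φ μ) P := hE.add hΦ
  have hmono := integral_mono_ae hIenv hIEΦ (envelope_le_ae hfloor hcap)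
  rw [integral_envelope hK c D, integral_add hE hΦ] at hmono
  have hcredit : m * P.real (⋃ i ∈ Finset.range n, K i) ≤ ∑ i ∈ Finset.range n, mK i * P.real (rowCell K i) :=
    mul_measureReal_le_credit hK hm
  have hcompl : P.real (⋃ i ∈ Finset.range n, K i)ᶜ = 1 - P.real (⋃ i ∈ Finset.range n, K i) := probReal_compl_eq_one_sub hU
  have h1 : P.real (⋃ i ∈ Finset.range n, K i)ᶜ * (m + D) < m := by
    have := hmass
    unfold reach at this
    rwa [lt_div_iff₀ (by linarith)] at this
  have h2 : m * P.real (⋃ i ∈ Finset.range n, K i)ᶜ + D * P.real (⋃ i ∈ Finset.range n, K i)ᶜ < m := by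
    have h := h1
    rw [mul_add, mul_comm _ m, mul_comm _ D] at h
    exact h
  have h3 : m * P.real (⋃ i ∈ Finset.range n, K i) = m - m * P.real (⋃ i ∈ Finset.range n, K i)ᶜ := by rw [hcompl]; ring
  linarith

/-- The law-level reach lemma for the ROOT ENERGY of a law a.s. carried by rooted `δ`-hard-core configurations (integrability by name), any null
ledger `Φ`, the cap read only on the uncovered set. [new: bookkeeping] -/
theorem lt_integral_rootEnergy_of_massLedger [IsProbabilityMeasure P] {δ : ℝ} (hδ : 0 < δ) (hcore : ∀ᵐ μ ∂P, IsRootedHardCore δ μ)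
    {Φ : Measure E3 → ℝ} (hΦ : Integrable Φ P) (hΦ0 : ∫ μ, Φ μ ∂P ≤ 0) (hK : ∀ i, MeasurableSet (K i)) {c m D : ℝ} (hm0 : 0 < m) (hD : 0 ≤ D)
    (hm : ∀ i < n, m ≤ mK i) (hfloor : ∀ i < n, ∀ᵐ μ ∂P, μ ∈ K i → c + mK i ≤ rootEnergy lennardJones μ + Φ μ)
    (hcap : ∀ᵐ μ ∂P, μ ∉ (⋃ i ∈ Finset.range n, K i) → c - rootEnergy lennardJones μ - Φ μ ≤ D)
    (hmass : P.real (⋃ i ∈ Finset.range n, K i)ᶜ < reach m D) : c < ∫ μ, rootEnergy lennardJones μ ∂P :=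
  lt_integral_of_atlasLedger (integrable_rootEnergy_of_ae_hardCore hδ hcore) hΦ hΦ0 hK hm0 hD hm hfloor hcap hmass

/-! ## §2. Crux level: floors on rows at Nash roots, the cap only at uncovered Nash roots, any admissible null ledger -/

/-- ★★ **THE REACH THEOREM, GENERAL FORM.**  A ledger `Φ` integrable with mean `≤ 0` under every point-stationary probability law a.s. carried by
rooted `7/10`-hard-core configurations; deterministic floors `e⋆ + m_i ≤ rootEnergy μ + Φ μ` at the rooted `7/10`-hard-core NASH configurations of
row `i < n` (margins `m_i ≥ m > 0`); a deterministic cap `e⋆ − rootEnergy μ − Φ μ ≤ D` (`D ≥ 0`) required ONLY at rooted `7/10`-hard-core NASH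
configurations lying in NO row: then F(η) `CoherentMassExclusion n K η` for every `η ≤ reach m D`. [new: junction] -/
theorem coherentMassExclusion_of_floorsL (n : ℕ) (K : ℕ → Set (MeasureTheory.Measure (EuclideanSpace ℝ (Fin 3)))) (hK : ∀ i, MeasurableSet (K i))
    (mK : ℕ → ℝ) (Φ : Measure E3 → ℝ)
    (hΦ : ∀ P : Measure (Measure E3), IsProbabilityMeasure P → (∀ᵐ μ ∂P, IsRootedHardCore (7 / 10) μ) → IsPointStationaryLaw P →
      Integrable Φ P ∧ ∫ μ, Φ μ ∂P ≤ 0)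
    (hfloorL : ∀ i < n, ∀ μ : Measure E3, IsRootedHardCore (7 / 10) μ →
      (∀ p : E3, μ {p} ≠ 0 → ∀ y : E3, (∀ q : E3, μ {q} ≠ 0 → q ≠ p → y ≠ q) →
        ∑' q : {q : E3 // μ {q} ≠ 0 ∧ q ≠ p}, lennardJones (dist p (q : E3)) ≤ ∑' q : {q : E3 // μ {q} ≠ 0 ∧ q ≠ p}, lennardJones (dist y (q : E3))) →
      μ ∈ K i → eStar + mK i ≤ rootEnergy lennardJones μ + Φ μ)
    {m D : ℝ} (hm0 : 0 < m) (hD : 0 ≤ D) (hm : ∀ i < n, m ≤ mK i)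
    (hcapL : ∀ μ : Measure E3, IsRootedHardCore (7 / 10) μ →
      (∀ p : E3, μ {p} ≠ 0 → ∀ y : E3, (∀ q : E3, μ {q} ≠ 0 → q ≠ p → y ≠ q) →
        ∑' q : {q : E3 // μ {q} ≠ 0 ∧ q ≠ p}, lennardJones (dist p (q : E3)) ≤ ∑' q : {q : E3 // μ {q} ≠ 0 ∧ q ≠ p}, lennardJones (dist y (q : E3))) →
      μ ∉ (⋃ i ∈ Finset.range n, K i) → eStar - rootEnergy lennardJones μ - Φ μ ≤ D)
    {η : ℝ} (hη : η ≤ reach m D) : CoherentMassExclusion n K η := by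
  intro P
  dsimp only
  intro hP ha hb hd he h0 hmin hmass
  have h7 : (0 : ℝ) < 7 / 10 := by norm_num
  obtain ⟨hΦI, hΦ0⟩ := hΦ P hP ha hb
  have hfl : ∀ i < n, ∀ᵐ μ ∂P, μ ∈ K i → eStar + mK i ≤ rootEnergy lennardJones μ + Φ μ := fun i hi => by
    filter_upwards [ha, he] with μ hμ hN hμi using hfloorL i hi μ hμ hN hμi
  have hcp : ∀ᵐ μ ∂P, μ ∉ (⋃ i ∈ Finset.range n, K i) → eStar - rootEnergy lennardJones μ - Φ μ ≤ D := by
    filter_upwards [ha, he] with μ hμ hN hμU using hcapL μ hμ hN hμU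
  have hlt : eStar < ∫ μ, rootEnergy lennardJones μ ∂P :=
    lt_integral_rootEnergy_of_massLedger h7 ha hΦI hΦ0 hK hm0 hD hm hfl hcp (lt_of_lt_of_le hmass hη)
  exact absurd hmin (not_le.2 hlt)

/-- ★★ JUNCTION TO THE CRUX (the mass split of (404), by name): the general floors, the shrunk cap slot, a null ledger, and the residual
A(η) = `OffAtlasMassGap n K η` at some `η ≤ reach m D` prove `AperiodicFrustratedLawGap`. [new: junction] -/
theorem aperiodicFrustratedLawGap_of_offAtlasMassGapL (n : ℕ) (K : ℕ → Set (MeasureTheory.Measure (EuclideanSpace ℝ (Fin 3))))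
    (hK : ∀ i, MeasurableSet (K i)) (mK : ℕ → ℝ) (Φ : Measure E3 → ℝ)
    (hΦ : ∀ P : Measure (Measure E3), IsProbabilityMeasure P → (∀ᵐ μ ∂P, IsRootedHardCore (7 / 10) μ) → IsPointStationaryLaw P →
      Integrable Φ P ∧ ∫ μ, Φ μ ∂P ≤ 0)
    (hfloorL : ∀ i < n, ∀ μ : Measure E3, IsRootedHardCore (7 / 10) μ →
      (∀ p : E3, μ {p} ≠ 0 → ∀ y : E3, (∀ q : E3, μ {q} ≠ 0 → q ≠ p → y ≠ q) →
        ∑' q : {q : E3 // μ {q} ≠ 0 ∧ q ≠ p}, lennardJones (dist p (q : E3)) ≤ ∑' q : {q : E3 // μ {q} ≠ 0 ∧ q ≠ p}, lennardJones (dist y (q : E3))) →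
      μ ∈ K i → eStar + mK i ≤ rootEnergy lennardJones μ + Φ μ)
    {m D : ℝ} (hm0 : 0 < m) (hD : 0 ≤ D) (hm : ∀ i < n, m ≤ mK i)
    (hcapL : ∀ μ : Measure E3, IsRootedHardCore (7 / 10) μ →
      (∀ p : E3, μ {p} ≠ 0 → ∀ y : E3, (∀ q : E3, μ {q} ≠ 0 → q ≠ p → y ≠ q) →
        ∑' q : {q : E3 // μ {q} ≠ 0 ∧ q ≠ p}, lennardJones (dist p (q : E3)) ≤ ∑' q : {q : E3 // μ {q} ≠ 0 ∧ q ≠ p}, lennardJones (dist y (q : E3))) →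
      μ ∉ (⋃ i ∈ Finset.range n, K i) → eStar - rootEnergy lennardJones μ - Φ μ ≤ D)
    {η : ℝ} (hη : η ≤ reach m D) (hA : OffAtlasMassGap n K η) :
    Summit.AtomisticToContinuum.Crystallization.Theses.FrustratedLawDichotomy.AperiodicFrustratedLawGap :=
  aperiodicFrustratedLawGap_of_massSplit n K η (coherentMassExclusion_of_floorsL n K hK mK Φ hΦ hfloorL hm0 hD hm hcapL hη) hA

/-! ## §3. Specialisations by name: the zero ledger ((404)'s floors) and the transported ledger ((404′)'s floors), cap slot shrunk -/

/-- ★ (404) WITH THE CAP SLOT SHRUNK: (404)'s row floors verbatim (rooted `7/10`-hard-core Nash configurations of each row, margins `≥ m > 0`) and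
a sitewise cap `e⋆ − rootEnergy μ ≤ D` required ONLY at rooted `7/10`-hard-core NASH configurations outside every row give F(η), `η ≤ reach m D`.
((404) `coherentMassExclusion_of_floors` is the sub-case whose cap is asked at every rooted hard-core configuration.) [new: junction] -/
theorem coherentMassExclusion_of_floors_nashCap (n : ℕ) (K : ℕ → Set (MeasureTheory.Measure (EuclideanSpace ℝ (Fin 3))))
    (hK : ∀ i, MeasurableSet (K i)) (mK : ℕ → ℝ)
    (hfloor : ∀ i < n, ∀ μ : Measure E3, IsRootedHardCore (7 / 10) μ →
      (∀ p : E3, μ {p} ≠ 0 → ∀ y : E3, (∀ q : E3, μ {q} ≠ 0 → q ≠ p → y ≠ q) →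
        ∑' q : {q : E3 // μ {q} ≠ 0 ∧ q ≠ p}, lennardJones (dist p (q : E3)) ≤ ∑' q : {q : E3 // μ {q} ≠ 0 ∧ q ≠ p}, lennardJones (dist y (q : E3))) →
      μ ∈ K i → eStar + mK i ≤ rootEnergy lennardJones μ)
    {m D : ℝ} (hm0 : 0 < m) (hD : 0 ≤ D) (hm : ∀ i < n, m ≤ mK i)
    (hcapN : ∀ μ : Measure E3, IsRootedHardCore (7 / 10) μ →
      (∀ p : E3, μ {p} ≠ 0 → ∀ y : E3, (∀ q : E3, μ {q} ≠ 0 → q ≠ p → y ≠ q) →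
        ∑' q : {q : E3 // μ {q} ≠ 0 ∧ q ≠ p}, lennardJones (dist p (q : E3)) ≤ ∑' q : {q : E3 // μ {q} ≠ 0 ∧ q ≠ p}, lennardJones (dist y (q : E3))) →
      μ ∉ (⋃ i ∈ Finset.range n, K i) → eStar - rootEnergy lennardJones μ ≤ D)
    {η : ℝ} (hη : η ≤ reach m D) : CoherentMassExclusion n K η :=
  coherentMassExclusion_of_floorsL n K hK mK (fun _ => 0) (fun P _ _ _ => ⟨integrable_const (0 : ℝ), by simp⟩)
    (fun i hi μ hμ hN hμi => by rw [add_zero]; exact hfloor i hi μ hμ hN hμi) hm0 hD hm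
    (fun μ hμ hN hμU => by rw [sub_zero]; exact hcapN μ hμ hN hμU) hη

/-- junction: (404)'s floors + the shrunk sitewise cap + A(η) ⟹ crux. [new: junction] -/
theorem aperiodicFrustratedLawGap_of_offAtlasMassGap_nashCap (n : ℕ) (K : ℕ → Set (MeasureTheory.Measure (EuclideanSpace ℝ (Fin 3))))
    (hK : ∀ i, MeasurableSet (K i)) (mK : ℕ → ℝ)
    (hfloor : ∀ i < n, ∀ μ : Measure E3, IsRootedHardCore (7 / 10) μ →
      (∀ p : E3, μ {p} ≠ 0 → ∀ y : E3, (∀ q : E3, μ {q} ≠ 0 → q ≠ p → y ≠ q) →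
        ∑' q : {q : E3 // μ {q} ≠ 0 ∧ q ≠ p}, lennardJones (dist p (q : E3)) ≤ ∑' q : {q : E3 // μ {q} ≠ 0 ∧ q ≠ p}, lennardJones (dist y (q : E3))) →
      μ ∈ K i → eStar + mK i ≤ rootEnergy lennardJones μ)
    {m D : ℝ} (hm0 : 0 < m) (hD : 0 ≤ D) (hm : ∀ i < n, m ≤ mK i)
    (hcapN : ∀ μ : Measure E3, IsRootedHardCore (7 / 10) μ →
      (∀ p : E3, μ {p} ≠ 0 → ∀ y : E3, (∀ q : E3, μ {q} ≠ 0 → q ≠ p → y ≠ q) →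
        ∑' q : {q : E3 // μ {q} ≠ 0 ∧ q ≠ p}, lennardJones (dist p (q : E3)) ≤ ∑' q : {q : E3 // μ {q} ≠ 0 ∧ q ≠ p}, lennardJones (dist y (q : E3))) →
      μ ∉ (⋃ i ∈ Finset.range n, K i) → eStar - rootEnergy lennardJones μ ≤ D)
    {η : ℝ} (hη : η ≤ reach m D) (hA : OffAtlasMassGap n K η) :
    Summit.AtomisticToContinuum.Crystallization.Theses.FrustratedLawDichotomy.AperiodicFrustratedLawGap :=
  aperiodicFrustratedLawGap_of_massSplit n K η (coherentMassExclusion_of_floors_nashCap n K hK mK hfloor hm0 hD hm hcapN hη) hA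

/-- The net flow of two jointly measurable covariant transports with out-flows bounded on rooted `7/10`-hard-core configurations is an admissible
NULL LEDGER: integrable with mean `0` under every point-stationary probability law a.s. carried by rooted `7/10`-hard-core configurations
(`…SignedLedger.integral_net_eq_zero` + `…AtlasDoorTransport.lintegral_outflow_ne_top_of_bdd`, by name). [folklore: mass transport] -/
theorem net_nullLedger (F G : Measure E3 → E3 → ℝ≥0∞) (hF : Measurable (Function.uncurry F)) (hG : Measurable (Function.uncurry G))
    {BF BG : ℝ≥0∞} (hBF : BF ≠ ∞) (hBG : BG ≠ ∞) (hFb : ∀ μ : Measure E3, IsRootedHardCore (7 / 10) μ → ∫⁻ y, F μ y ∂μ ≤ BF)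
    (hGb : ∀ μ : Measure E3, IsRootedHardCore (7 / 10) μ → ∫⁻ y, G μ y ∂μ ≤ BG) :
    ∀ P : Measure (Measure E3), IsProbabilityMeasure P → (∀ᵐ μ ∂P, IsRootedHardCore (7 / 10) μ) → IsPointStationaryLaw P →
      Integrable (net F G) P ∧ ∫ μ, net F G μ ∂P ≤ 0 := fun P hP ha hb => by
  obtain ⟨hI, h0⟩ := integral_net_eq_zero (by norm_num : (0 : ℝ) < 7 / 10) ha hb hF hG (lintegral_outflow_ne_top_of_bdd ha hBF hFb)
    (lintegral_outflow_ne_top_of_bdd ha hBG hGb)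
  exact ⟨hI, h0.le⟩

/-- ★ (404′) WITH THE CAP SLOT SHRUNK: transported row floors `e⋆ + m_i ≤ rootEnergy μ + net F G μ` at rooted `7/10`-hard-core Nash configurations of each
row (door clauses of (325) for `F`, `G`), and a transported cap `e⋆ − rootEnergy μ − net F G μ ≤ D` required ONLY at rooted `7/10`-hard-core NASH
configurations outside every row, give F(η) for `η ≤ reach m D`.  ((404′) `coherentMassExclusion_of_floorsT` asks the cap at every rooted hard-core
configuration.) [new: junction] -/
theorem coherentMassExclusion_of_floorsT_nashCap (n : ℕ) (K : ℕ → Set (MeasureTheory.Measure (EuclideanSpace ℝ (Fin 3))))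
    (hK : ∀ i, MeasurableSet (K i)) (mK : ℕ → ℝ) (F G : Measure E3 → E3 → ℝ≥0∞) (hF : Measurable (Function.uncurry F))
    (hG : Measurable (Function.uncurry G)) {BF BG : ℝ≥0∞} (hBF : BF ≠ ∞) (hBG : BG ≠ ∞)
    (hFb : ∀ μ : Measure E3, IsRootedHardCore (7 / 10) μ → ∫⁻ y, F μ y ∂μ ≤ BF) (hGb : ∀ μ : Measure E3, IsRootedHardCore (7 / 10) μ → ∫⁻ y, G μ y ∂μ ≤ BG)
    (hfloorT : ∀ i < n, ∀ μ : Measure E3, IsRootedHardCore (7 / 10) μ →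
      (∀ p : E3, μ {p} ≠ 0 → ∀ y : E3, (∀ q : E3, μ {q} ≠ 0 → q ≠ p → y ≠ q) →
        ∑' q : {q : E3 // μ {q} ≠ 0 ∧ q ≠ p}, lennardJones (dist p (q : E3)) ≤ ∑' q : {q : E3 // μ {q} ≠ 0 ∧ q ≠ p}, lennardJones (dist y (q : E3))) →
      μ ∈ K i → eStar + mK i ≤ rootEnergy lennardJones μ + net F G μ)
    {m D : ℝ} (hm0 : 0 < m) (hD : 0 ≤ D) (hm : ∀ i < n, m ≤ mK i)
    (hcapTN : ∀ μ : Measure E3, IsRootedHardCore (7 / 10) μ →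
      (∀ p : E3, μ {p} ≠ 0 → ∀ y : E3, (∀ q : E3, μ {q} ≠ 0 → q ≠ p → y ≠ q) →
        ∑' q : {q : E3 // μ {q} ≠ 0 ∧ q ≠ p}, lennardJones (dist p (q : E3)) ≤ ∑' q : {q : E3 // μ {q} ≠ 0 ∧ q ≠ p}, lennardJones (dist y (q : E3))) →
      μ ∉ (⋃ i ∈ Finset.range n, K i) → eStar - rootEnergy lennardJones μ - net F G μ ≤ D)
    {η : ℝ} (hη : η ≤ reach m D) : CoherentMassExclusion n K η :=
  coherentMassExclusion_of_floorsL n K hK mK (net F G) (net_nullLedger F G hF hG hBF hBG hFb hGb) hfloorT hm0 hD hm hcapTN hη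

/-- junction: transported floors + the shrunk transported cap + A(η) ⟹ crux. [new: junction] -/
theorem aperiodicFrustratedLawGap_of_offAtlasMassGapT_nashCap (n : ℕ) (K : ℕ → Set (MeasureTheory.Measure (EuclideanSpace ℝ (Fin 3))))
    (hK : ∀ i, MeasurableSet (K i)) (mK : ℕ → ℝ) (F G : Measure E3 → E3 → ℝ≥0∞) (hF : Measurable (Function.uncurry F))
    (hG : Measurable (Function.uncurry G)) {BF BG : ℝ≥0∞} (hBF : BF ≠ ∞) (hBG : BG ≠ ∞)
    (hFb : ∀ μ : Measure E3, IsRootedHardCore (7 / 10) μ → ∫⁻ y, F μ y ∂μ ≤ BF) (hGb : ∀ μ : Measure E3, IsRootedHardCore (7 / 10) μ → ∫⁻ y, G μ y ∂μ ≤ BG)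
    (hfloorT : ∀ i < n, ∀ μ : Measure E3, IsRootedHardCore (7 / 10) μ →
      (∀ p : E3, μ {p} ≠ 0 → ∀ y : E3, (∀ q : E3, μ {q} ≠ 0 → q ≠ p → y ≠ q) →
        ∑' q : {q : E3 // μ {q} ≠ 0 ∧ q ≠ p}, lennardJones (dist p (q : E3)) ≤ ∑' q : {q : E3 // μ {q} ≠ 0 ∧ q ≠ p}, lennardJones (dist y (q : E3))) →
      μ ∈ K i → eStar + mK i ≤ rootEnergy lennardJones μ + net F G μ)
    {m D : ℝ} (hm0 : 0 < m) (hD : 0 ≤ D) (hm : ∀ i < n, m ≤ mK i)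
    (hcapTN : ∀ μ : Measure E3, IsRootedHardCore (7 / 10) μ →
      (∀ p : E3, μ {p} ≠ 0 → ∀ y : E3, (∀ q : E3, μ {q} ≠ 0 → q ≠ p → y ≠ q) →
        ∑' q : {q : E3 // μ {q} ≠ 0 ∧ q ≠ p}, lennardJones (dist p (q : E3)) ≤ ∑' q : {q : E3 // μ {q} ≠ 0 ∧ q ≠ p}, lennardJones (dist y (q : E3))) →
      μ ∉ (⋃ i ∈ Finset.range n, K i) → eStar - rootEnergy lennardJones μ - net F G μ ≤ D)
    {η : ℝ} (hη : η ≤ reach m D) (hA : OffAtlasMassGap n K η) :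
    Summit.AtomisticToContinuum.Crystallization.Theses.FrustratedLawDichotomy.AperiodicFrustratedLawGap :=
  aperiodicFrustratedLawGap_of_massSplit n K η
    (coherentMassExclusion_of_floorsT_nashCap n K hK mK F G hF hG hBF hBG hFb hGb hfloorT hm0 hD hm hcapTN hη) hA

/-! ## §4. The quantitative form: the ENERGY–MASS INEQUALITY (appended, hand-2 g50; §1–§3 above byte-identical)
Integrating the same booked envelope WITHOUT the mass hypothesis: `c + m − (m + D)·P(U) ≤ ∫ E dP`, i.e. ★ `P(U) ≥ (m − (∫E − c))/(m + D)` — the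
mean excess energy over `c` is the only currency that buys atlas-coherence.  At crux level this uses ONLY clauses (a) hard core, (b) point-stationarity,
(e) Nash and a bound `E_P[rootEnergy] ≤ e⋆ + ε` — NOT texture (d), NOT aperiodicity, NOT exact minimality (`offAtlasMass_ge_of_floorsL`; `ε = 0` = reach). -/

/-- ★★ **THE ENERGY–MASS INEQUALITY** (quantitative form of `lt_integral_of_atlasLedger`; no sign hypothesis on `m`, `D`): an integrable functional
`E`, an integrable null ledger `Φ` (`∫ Φ dP ≤ 0`), rows with a.s. floors `c + m_i ≤ E + Φ` and margins `m_i ≥ m`, and an a.s. cap `c − E − Φ ≤ D`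
on the uncovered set `U` give `c + m − (m + D)·P(U) ≤ ∫ E dP`. [new: bookkeeping] -/
theorem le_integral_of_atlasLedger [IsProbabilityMeasure P] {E Φ : Measure E3 → ℝ} (hE : Integrable E P) (hΦ : Integrable Φ P)
    (hΦ0 : ∫ μ, Φ μ ∂P ≤ 0) (hK : ∀ i, MeasurableSet (K i)) {c m D : ℝ} (hm : ∀ i < n, m ≤ mK i)
    (hfloor : ∀ i < n, ∀ᵐ μ ∂P, μ ∈ K i → c + mK i ≤ E μ + Φ μ)
    (hcap : ∀ᵐ μ ∂P, μ ∉ (⋃ i ∈ Finset.range n, K i) → c - E μ - Φ μ ≤ D) :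
    c + m - (m + D) * P.real (⋃ i ∈ Finset.range n, K i)ᶜ ≤ ∫ μ, E μ ∂P := by
  have hU : MeasurableSet (⋃ i ∈ Finset.range n, K i) := Finset.measurableSet_biUnion _ fun j _ => hK j
  have hI1 : Integrable (fun μ => ∑ j ∈ Finset.range n, (rowCell K j).indicator (fun _ => mK j) μ) P :=
    integrable_finsetSum _ fun i _ => (integrable_const (mK i)).indicator (measurableSet_rowCell hK i)
  have hI2 : Integrable ((⋃ i ∈ Finset.range n, K i)ᶜ.indicator fun _ => D) P := (integrable_const D).indicator hU.compl
  have hIenv : Integrable (fun μ => c + (∑ j ∈ Finset.range n, (rowCell K j).indicator (fun _ => mK j) μ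
      - (⋃ i ∈ Finset.range n, K i)ᶜ.indicator (fun _ => D) μ)) P := (integrable_const c).add (hI1.sub hI2)
  have hIEΦ : Integrable (fun μ => E μ + Φ μ) P := hE.add hΦ
  have hmono := integral_mono_ae hIenv hIEΦ (envelope_le_ae hfloor hcap)
  rw [integral_envelope hK c D, integral_add hE hΦ] at hmono
  have hcredit : m * P.real (⋃ i ∈ Finset.range n, K i) ≤ ∑ i ∈ Finset.range n, mK i * P.real (rowCell K i) :=
    mul_measureReal_le_credit hK hm
  have hcompl : P.real (⋃ i ∈ Finset.range n, K i)ᶜ = 1 - P.real (⋃ i ∈ Finset.range n, K i) := probReal_compl_eq_one_sub hU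
  have h3 : m * P.real (⋃ i ∈ Finset.range n, K i) = m - m * P.real (⋃ i ∈ Finset.range n, K i)ᶜ := by rw [hcompl]; ring
  have h4 : (m + D) * P.real (⋃ i ∈ Finset.range n, K i)ᶜ = m * P.real (⋃ i ∈ Finset.range n, K i)ᶜ + D * P.real (⋃ i ∈ Finset.range n, K i)ᶜ := by
    ring
  linarith

/-- ★ THE OFF-ATLAS MASS FLOOR: with `0 < m + D` and a mean-energy bound `∫ E dP ≤ c + ε`, the uncovered set carries `P(U) ≥ (m − ε)/(m + D)`.
(`ε = 0`: `P(U) ≥ reach m D`, the contrapositive of `lt_integral_of_atlasLedger`; the bound is informative for all `ε < m`.) [new: bookkeeping] -/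
theorem offAtlasMass_ge_of_atlasLedger [IsProbabilityMeasure P] {E Φ : Measure E3 → ℝ} (hE : Integrable E P) (hΦ : Integrable Φ P)
    (hΦ0 : ∫ μ, Φ μ ∂P ≤ 0) (hK : ∀ i, MeasurableSet (K i)) {c m D ε : ℝ} (hmD : 0 < m + D) (hm : ∀ i < n, m ≤ mK i)
    (hfloor : ∀ i < n, ∀ᵐ μ ∂P, μ ∈ K i → c + mK i ≤ E μ + Φ μ)
    (hcap : ∀ᵐ μ ∂P, μ ∉ (⋃ i ∈ Finset.range n, K i) → c - E μ - Φ μ ≤ D) (hmean : ∫ μ, E μ ∂P ≤ c + ε) :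
    (m - ε) / (m + D) ≤ P.real (⋃ i ∈ Finset.range n, K i)ᶜ := by
  rw [div_le_iff₀ hmD]
  have h := le_integral_of_atlasLedger hE hΦ hΦ0 hK hm hfloor hcap
  have h' : (m + D) * P.real (⋃ i ∈ Finset.range n, K i)ᶜ = P.real (⋃ i ∈ Finset.range n, K i)ᶜ * (m + D) := mul_comm _ _
  linarith

/-- ★★ **THE ENERGY–MASS INEQUALITY AT CRUX LEVEL** — clauses (a), (b), (e) ONLY.  A ledger `Φ` integrable with mean `≤ 0` under every
point-stationary probability law a.s. carried by rooted `7/10`-hard-core configurations; floors `e⋆ + m_i ≤ rootEnergy μ + Φ μ` at the rooted hard-core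
Nash configurations of row `i < n` (margins `≥ m`); a cap `e⋆ − rootEnergy μ − Φ μ ≤ D` at the rooted hard-core Nash configurations outside every row;
`0 < m + D`.  Then EVERY point-stationary probability law that is a.s. rooted `7/10`-hard-core and a.s. Nash with `E_P[rootEnergy] ≤ e⋆ + ε` puts mass
`≥ (m − ε)/(m + D)` on the uncovered set — texture, aperiodicity and exact minimality are not used. [new: junction] -/
theorem offAtlasMass_ge_of_floorsL (n : ℕ) (K : ℕ → Set (MeasureTheory.Measure (EuclideanSpace ℝ (Fin 3)))) (hK : ∀ i, MeasurableSet (K i))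
    (mK : ℕ → ℝ) (Φ : Measure E3 → ℝ)
    (hΦ : ∀ P : Measure (Measure E3), IsProbabilityMeasure P → (∀ᵐ μ ∂P, IsRootedHardCore (7 / 10) μ) → IsPointStationaryLaw P →
      Integrable Φ P ∧ ∫ μ, Φ μ ∂P ≤ 0)
    (hfloorL : ∀ i < n, ∀ μ : Measure E3, IsRootedHardCore (7 / 10) μ →
      (∀ p : E3, μ {p} ≠ 0 → ∀ y : E3, (∀ q : E3, μ {q} ≠ 0 → q ≠ p → y ≠ q) →
        ∑' q : {q : E3 // μ {q} ≠ 0 ∧ q ≠ p}, lennardJones (dist p (q : E3)) ≤ ∑' q : {q : E3 // μ {q} ≠ 0 ∧ q ≠ p}, lennardJones (dist y (q : E3))) →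
      μ ∈ K i → eStar + mK i ≤ rootEnergy lennardJones μ + Φ μ)
    {m D : ℝ} (hmD : 0 < m + D) (hm : ∀ i < n, m ≤ mK i)
    (hcapL : ∀ μ : Measure E3, IsRootedHardCore (7 / 10) μ →
      (∀ p : E3, μ {p} ≠ 0 → ∀ y : E3, (∀ q : E3, μ {q} ≠ 0 → q ≠ p → y ≠ q) →
        ∑' q : {q : E3 // μ {q} ≠ 0 ∧ q ≠ p}, lennardJones (dist p (q : E3)) ≤ ∑' q : {q : E3 // μ {q} ≠ 0 ∧ q ≠ p}, lennardJones (dist y (q : E3))) →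
      μ ∉ (⋃ i ∈ Finset.range n, K i) → eStar - rootEnergy lennardJones μ - Φ μ ≤ D)
    (P : Measure (Measure E3)) [IsProbabilityMeasure P] (ha : ∀ᵐ μ ∂P, IsRootedHardCore (7 / 10) μ) (hb : IsPointStationaryLaw P)
    (he : ∀ᵐ μ ∂P, ∀ p : E3, μ {p} ≠ 0 → ∀ y : E3, (∀ q : E3, μ {q} ≠ 0 → q ≠ p → y ≠ q) →
      ∑' q : {q : E3 // μ {q} ≠ 0 ∧ q ≠ p}, lennardJones (dist p (q : E3)) ≤ ∑' q : {q : E3 // μ {q} ≠ 0 ∧ q ≠ p}, lennardJones (dist y (q : E3)))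
    {ε : ℝ} (hmean : ∫ μ, rootEnergy lennardJones μ ∂P ≤ eStar + ε) :
    (m - ε) / (m + D) ≤ P.real (⋃ i ∈ Finset.range n, K i)ᶜ := by
  obtain ⟨hΦI, hΦ0⟩ := hΦ P inferInstance ha hb
  have hfl : ∀ i < n, ∀ᵐ μ ∂P, μ ∈ K i → eStar + mK i ≤ rootEnergy lennardJones μ + Φ μ := fun i hi => by
    filter_upwards [ha, he] with μ hμ hN hμi using hfloorL i hi μ hμ hN hμi
  have hcp : ∀ᵐ μ ∂P, μ ∉ (⋃ i ∈ Finset.range n, K i) → eStar - rootEnergy lennardJones μ - Φ μ ≤ D := by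
    filter_upwards [ha, he] with μ hμ hN hμU using hcapL μ hμ hN hμU
  exact offAtlasMass_ge_of_atlasLedger (integrable_rootEnergy_of_ae_hardCore (by norm_num : (0 : ℝ) < 7 / 10) ha) hΦI hΦ0 hK hmD hm hfl hcp
    hmean

/-- ★ Φ = 0: (404)'s floors (margins `≥ m`), a sitewise cap at uncovered Nash roots, `0 < m + D` ⟹ every a.s. hard-core, point-stationary, a.s. Nash law
with `E_P[rootEnergy] ≤ e⋆ + ε` has `P(U) ≥ (m − ε)/(m + D)`. [new: junction] -/
theorem offAtlasMass_ge_of_floors_nashCap (n : ℕ) (K : ℕ → Set (MeasureTheory.Measure (EuclideanSpace ℝ (Fin 3)))) (hK : ∀ i, MeasurableSet (K i))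
    (mK : ℕ → ℝ)
    (hfloor : ∀ i < n, ∀ μ : Measure E3, IsRootedHardCore (7 / 10) μ →
      (∀ p : E3, μ {p} ≠ 0 → ∀ y : E3, (∀ q : E3, μ {q} ≠ 0 → q ≠ p → y ≠ q) →
        ∑' q : {q : E3 // μ {q} ≠ 0 ∧ q ≠ p}, lennardJones (dist p (q : E3)) ≤ ∑' q : {q : E3 // μ {q} ≠ 0 ∧ q ≠ p}, lennardJones (dist y (q : E3))) →
      μ ∈ K i → eStar + mK i ≤ rootEnergy lennardJones μ)
    {m D : ℝ} (hmD : 0 < m + D) (hm : ∀ i < n, m ≤ mK i)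
    (hcapN : ∀ μ : Measure E3, IsRootedHardCore (7 / 10) μ →
      (∀ p : E3, μ {p} ≠ 0 → ∀ y : E3, (∀ q : E3, μ {q} ≠ 0 → q ≠ p → y ≠ q) →
        ∑' q : {q : E3 // μ {q} ≠ 0 ∧ q ≠ p}, lennardJones (dist p (q : E3)) ≤ ∑' q : {q : E3 // μ {q} ≠ 0 ∧ q ≠ p}, lennardJones (dist y (q : E3))) →
      μ ∉ (⋃ i ∈ Finset.range n, K i) → eStar - rootEnergy lennardJones μ ≤ D)
    (P : Measure (Measure E3)) [IsProbabilityMeasure P] (ha : ∀ᵐ μ ∂P, IsRootedHardCore (7 / 10) μ) (hb : IsPointStationaryLaw P)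
    (he : ∀ᵐ μ ∂P, ∀ p : E3, μ {p} ≠ 0 → ∀ y : E3, (∀ q : E3, μ {q} ≠ 0 → q ≠ p → y ≠ q) →
      ∑' q : {q : E3 // μ {q} ≠ 0 ∧ q ≠ p}, lennardJones (dist p (q : E3)) ≤ ∑' q : {q : E3 // μ {q} ≠ 0 ∧ q ≠ p}, lennardJones (dist y (q : E3)))
    {ε : ℝ} (hmean : ∫ μ, rootEnergy lennardJones μ ∂P ≤ eStar + ε) :
    (m - ε) / (m + D) ≤ P.real (⋃ i ∈ Finset.range n, K i)ᶜ :=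
  offAtlasMass_ge_of_floorsL n K hK mK (fun _ => 0) (fun P _ _ _ => ⟨integrable_const (0 : ℝ), by simp⟩)
    (fun i hi μ hμ hN hμi => by rw [add_zero]; exact hfloor i hi μ hμ hN hμi) hmD hm
    (fun μ hμ hN hμU => by rw [sub_zero]; exact hcapN μ hμ hN hμU) P ha hb he hmean

/-- ★ Φ = net F G (door clauses of (325)): transported floors, a transported cap at uncovered Nash roots, `0 < m + D` ⟹ the same mass floor
`P(U) ≥ (m − ε)/(m + D)` for every a.s. hard-core, point-stationary, a.s. Nash law with `E_P[rootEnergy] ≤ e⋆ + ε`. [new: junction] -/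
theorem offAtlasMass_ge_of_floorsT_nashCap (n : ℕ) (K : ℕ → Set (MeasureTheory.Measure (EuclideanSpace ℝ (Fin 3))))
    (hK : ∀ i, MeasurableSet (K i)) (mK : ℕ → ℝ) (F G : Measure E3 → E3 → ℝ≥0∞) (hF : Measurable (Function.uncurry F))
    (hG : Measurable (Function.uncurry G)) {BF BG : ℝ≥0∞} (hBF : BF ≠ ∞) (hBG : BG ≠ ∞)
    (hFb : ∀ μ : Measure E3, IsRootedHardCore (7 / 10) μ → ∫⁻ y, F μ y ∂μ ≤ BF) (hGb : ∀ μ : Measure E3, IsRootedHardCore (7 / 10) μ → ∫⁻ y, G μ y ∂μ ≤ BG)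
    (hfloorT : ∀ i < n, ∀ μ : Measure E3, IsRootedHardCore (7 / 10) μ →
      (∀ p : E3, μ {p} ≠ 0 → ∀ y : E3, (∀ q : E3, μ {q} ≠ 0 → q ≠ p → y ≠ q) →
        ∑' q : {q : E3 // μ {q} ≠ 0 ∧ q ≠ p}, lennardJones (dist p (q : E3)) ≤ ∑' q : {q : E3 // μ {q} ≠ 0 ∧ q ≠ p}, lennardJones (dist y (q : E3))) →
      μ ∈ K i → eStar + mK i ≤ rootEnergy lennardJones μ + net F G μ)
    {m D : ℝ} (hmD : 0 < m + D) (hm : ∀ i < n, m ≤ mK i)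
    (hcapTN : ∀ μ : Measure E3, IsRootedHardCore (7 / 10) μ →
      (∀ p : E3, μ {p} ≠ 0 → ∀ y : E3, (∀ q : E3, μ {q} ≠ 0 → q ≠ p → y ≠ q) →
        ∑' q : {q : E3 // μ {q} ≠ 0 ∧ q ≠ p}, lennardJones (dist p (q : E3)) ≤ ∑' q : {q : E3 // μ {q} ≠ 0 ∧ q ≠ p}, lennardJones (dist y (q : E3))) →
      μ ∉ (⋃ i ∈ Finset.range n, K i) → eStar - rootEnergy lennardJones μ - net F G μ ≤ D)
    (P : Measure (Measure E3)) [IsProbabilityMeasure P] (ha : ∀ᵐ μ ∂P, IsRootedHardCore (7 / 10) μ) (hb : IsPointStationaryLaw P)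
    (he : ∀ᵐ μ ∂P, ∀ p : E3, μ {p} ≠ 0 → ∀ y : E3, (∀ q : E3, μ {q} ≠ 0 → q ≠ p → y ≠ q) →
      ∑' q : {q : E3 // μ {q} ≠ 0 ∧ q ≠ p}, lennardJones (dist p (q : E3)) ≤ ∑' q : {q : E3 // μ {q} ≠ 0 ∧ q ≠ p}, lennardJones (dist y (q : E3)))
    {ε : ℝ} (hmean : ∫ μ, rootEnergy lennardJones μ ∂P ≤ eStar + ε) :
    (m - ε) / (m + D) ≤ P.real (⋃ i ∈ Finset.range n, K i)ᶜ :=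
  offAtlasMass_ge_of_floorsL n K hK mK (net F G) (net_nullLedger F G hF hG hBF hBG hFb hGb) hfloorT hmD hm hcapTN P ha hb he hmean

end Summit.AtomisticToContinuum.Crystallization.Theorems.FrustratedLawDichotomyAtlasReachLedger

end
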